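import Literature.NumberTheory.Irrationality.LaiYu2020.AuxiliaryFunctionProperties
import Literature.NumberTheory.Irrationality.LaiYu2020.ProgressionValuation
import Literature.NumberTheory.Irrationality.LaiYu2020.PartialFractionCoefficients
import HarnessLib

/-!
# Lai–Yu 2020, Lemma 3.3 (arithmetic lemma), first half, for the functions `R_n` — proofs

Topic `Literature/NumberTheory/Irrationality/LaiYu2020`. Companion ("Proofs") file for
L. Lai, P. Yu, *A note on the number of irrational odd zeta values*, Compositio Math. **156** (2020)
1699–1717 = arXiv:1911.08458 [LaiYu2020], §3 (arXiv text pp. 6–7):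

> «By Definition 2.3, we have `R_n(t) = n!^{s+1} ∏_{a/b ∈ 𝓕_B} F̃_{b,a}(t) / ∏_{j=0}^{n}(t+j)^{s+1}` (3.2)
> [with `F_{b,a}(t) = ∏_{p∣b} p^{(2r+1)n/(p−1)} / (n/den r)!^{den(r)(2r+1)} · ∏_j (bt − brn + a + bj)`].
> … **Lemma 3.3** (arithmetic lemma). We have `d_n^{s+1−i} ρ_i ∈ ℤ` for all odd integers `i` with
> `3 ≤ i ≤ s` … Proof. … By Proposition 3.2 and the fact `d_n^{ℓ_j}/(j−k)^{ℓ_j} ∈ ℤ`, we derive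
> that `d_n^{s+1−i} a_{i,k} ∈ ℤ`. Once `d_n^{s+1−i} a_{i,k} ∈ ℤ` is established, the rest of the proof
> is the same as [FSZ2019].»

This file assembles the tree's general pieces — `ProgressionValuation.prop32` (Prop. 3.2),
`PartialFractionCoefficients.partialFraction_coeff_isInt` (the coefficient extraction) — for the
functions `R_n` of `AuxiliaryFunction.lean` (`r = u/v`, `n = vm`, `(2r+1)n = (2u+v)m`, `rn = um`)
and PROVES **`D^{s+1−i} a_{i,k} ∈ ℤ`** for the partial-fraction coefficients `a_{i,k}` of `R_n` and
every common multiple `D` of `1, …, n` (`lemma33_coeff_isInt`; `D = d_n` is the printed case), hence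
`D^{s+1−i} ρ_i ∈ ℤ` for `ρ_i = ∑_k a_{i,k}` (`lemma33_rho_isInt`). On the way: the identity (3.2) in
the form `Φ_n = n!^{s+1} Φ₀` with `Φ₀(X−k)` a product of the normalised progression polynomials of
Prop. 3.2 (`A₁(B)ⁿ = ∏_{θ ∈ 𝓕_B} den(θ)^{(2r+1)n}`, `∏_{θ} ∏_{p ∣ den θ} p^{⌊(2r+1)n/(p−1)⌋} ∣ A₂(B)ⁿ` —
`prod_den_pow_eq_A₁pow`, `prod_mu_dvd_A₂pow` — so no use of the period `P_{B,den r}` is needed for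
this half). Theorems only, no definitions, no named facts; sorry-free. The second half
(`d_{n+1}^{s+1} ρ_{0,θ} ∈ ℤ`, "the same as [FSZ2019]") is not treated here.

## References

* [LaiYu2020] L. Lai, P. Yu, Compositio Math. 156 (2020) 1699–1717, §3 eq. (3.2) and Lemma 3.3.
-/

noncomputable section

open Finset Polynomial

namespace Literature.NumberTheory.Irrationality.LaiYu2020

/-! ### The fibres of `𝓕_B → Ψ_B`, `θ ↦ den θ` -/

/-- The elements of `𝓕_B` with reduced denominator `b ∈ Ψ_B` are the `a/b`, `1 ≤ a ≤ b`,
`gcd(a,b) = 1`; there are `φ(b)` of them. [cite: LaiYu2020, Def. 2.1 (2) and proof of Prop. 2.2 ("|𝓕_B| = ∑ φ(b)")] -/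
theorem card_zeroSet_fiber {B : ℝ} {b : ℕ} (hb : b ∈ denominatorSet B) :
    ((zeroSet_finite B).toFinset.filter fun θ : ℚ => θ.den = b).card = Nat.totient b := by
  classical
  have hb0 : 0 < b := ((mem_denominatorSet).1 hb).1
  rw [← Nat.filter_coprime_Ico_eq_totient b 1]
  symm
  refine card_nbij' (fun a : ℕ => (a : ℚ) / b) (fun θ : ℚ => θ.num.toNat) (fun a ha => ?_)
    (fun θ hθ => ?_) (fun a ha => ?_) (fun θ hθ => ?_)
  · -- `a/b ∈ 𝓕_B` with denominator `b`
    rw [mem_coe, mem_filter, mem_Ico] at ha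
    obtain ⟨⟨ha1, hab⟩, hcop⟩ := ha
    have hcop' : Nat.Coprime (a : ℤ).natAbs (b : ℤ).natAbs := by
      simpa [Int.natAbs_natCast] using hcop.symm
    have hden : (((a : ℤ) / (b : ℤ) : ℚ).den : ℤ) = b :=
      Rat.den_div_eq_of_coprime (by exact_mod_cast hb0) hcop'
    have hden' : ((a : ℚ) / b).den = b := by
      have : ((((a : ℤ) / (b : ℤ) : ℚ).den : ℤ)) = ((b : ℕ) : ℤ) := hden
      simpa using this
    dsimp only
    rw [mem_coe, mem_filter, Set.Finite.mem_toFinset]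
    refine ⟨div_mem_zeroSet hb ha1 (by omega) |> fun h => ?_, hden'⟩
    simpa using h
  · rw [mem_coe, mem_filter, Set.Finite.mem_toFinset] at hθ
    obtain ⟨hθF, hden⟩ := hθ
    obtain ⟨hpos, hle, -⟩ := (mem_zeroSet).1 hθF
    dsimp only
    rw [mem_coe, mem_filter, mem_Ico]
    have hnum : 0 < θ.num := Rat.num_pos.2 hpos
    have hnumden : θ.num ≤ θ.den := by
      have h := Rat.num_div_den θ
      have hd : (0 : ℚ) < θ.den := by exact_mod_cast θ.pos
      have : (θ.num : ℚ) ≤ θ.den := by rw [← h, div_le_one hd] at hle; exact hle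
      exact_mod_cast this
    refine ⟨⟨by omega, by rw [← hden]; omega⟩, ?_⟩
    have := θ.reduced
    rw [Nat.Coprime, Nat.gcd_comm] at this
    rw [Nat.Coprime, ← hden, show θ.num.toNat = θ.num.natAbs by omega]
    exact this
  · -- left inverse on `a`
    rw [mem_coe, mem_filter, mem_Ico] at ha
    obtain ⟨⟨ha1, hab⟩, hcop⟩ := ha
    have hcop' : Nat.Coprime (a : ℤ).natAbs (b : ℤ).natAbs := by
      simpa [Int.natAbs_natCast] using hcop.symm
    have h := Rat.num_div_eq_of_coprime (a := a) (b := b) (by exact_mod_cast hb0) hcop'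
    dsimp only
    have : ((a : ℚ) / b).num = a := by simpa using h
    rw [this]
    rfl
  · -- right inverse on `θ`
    rw [mem_coe, mem_filter, Set.Finite.mem_toFinset] at hθ
    obtain ⟨hθF, hden⟩ := hθ
    obtain ⟨hpos, -, -⟩ := (mem_zeroSet).1 hθF
    have hnum : 0 ≤ θ.num := (Rat.num_pos.2 hpos).le
    dsimp only
    rw [show ((θ.num.toNat : ℕ) : ℚ) = (θ.num : ℚ) by exact_mod_cast Int.toNat_of_nonneg hnum, ← hden]
    exact Rat.num_div_den θ

/-- **Products over `𝓕_B` through the denominator**: `∏_{θ ∈ 𝓕_B} g(den θ) = ∏_{b ∈ Ψ_B} g(b)^{φ(b)}`.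
[cite: LaiYu2020, Def. 2.1 (2) and proof of Prop. 2.2 ("|𝓕_B| = ∑ φ(b)")] -/
theorem prod_zeroSet_den {M : Type*} [CommMonoid M] (B : ℝ) (g : ℕ → M) :
    ∏ θ ∈ (zeroSet_finite B).toFinset, g θ.den =
      ∏ b ∈ (denominatorSet_finite B).toFinset, g b ^ Nat.totient b := by
  classical
  have hmaps : ∀ θ ∈ (zeroSet_finite B).toFinset, θ.den ∈ (denominatorSet_finite B).toFinset := by
    intro θ hθ
    rw [Set.Finite.mem_toFinset] at hθ ⊢
    exact ((mem_zeroSet).1 hθ).2.2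
  rw [← prod_fiberwise_of_maps_to hmaps]
  refine prod_congr rfl fun b hb => ?_
  rw [Set.Finite.mem_toFinset] at hb
  rw [← card_zeroSet_fiber hb, ← prod_const]
  exact prod_congr rfl fun θ hθ => by rw [(mem_filter.1 hθ).2]

/-- `A₁(B)ⁿ = ∏_{θ ∈ 𝓕_B} den(θ)^{(2r+1)n}`. [cite: LaiYu2020, §2 Def. 2.3 (A₁) with §3 eq. (3.2)] -/
theorem prod_den_pow_eq_A₁pow (u v : ℕ) (B : ℝ) (m : ℕ) :
    ∏ θ ∈ (zeroSet_finite B).toFinset, θ.den ^ ((2 * u + v) * m) = A₁pow u v B m := by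
  have h := prod_zeroSet_den B (fun b => b ^ ((2 * u + v) * m))
  rw [h, A₁pow]
  refine prod_congr rfl fun b _ => ?_
  rw [← pow_mul]

/-- `∏_{θ ∈ 𝓕_B} ∏_{p ∣ den θ} p^{⌊(2r+1)n/(p−1)⌋}` divides `A₂(B)ⁿ` (since `(p−1) ∣ φ(b)`).
[cite: LaiYu2020, §2 Def. 2.3 (A₂) with §3 eq. (3.2)] -/
theorem prod_mu_dvd_A₂pow (u v : ℕ) (B : ℝ) (m : ℕ) :
    (∏ θ ∈ (zeroSet_finite B).toFinset,
        ∏ p ∈ θ.den.primeFactors, p ^ ((2 * u + v) * m / (p - 1))) ∣ A₂pow u v B m := by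
  have h := prod_zeroSet_den B (fun b => ∏ p ∈ b.primeFactors, p ^ ((2 * u + v) * m / (p - 1)))
  rw [h, A₂pow]
  refine prod_dvd_prod_of_dvd _ _ fun b _ => ?_
  rw [← prod_pow]
  refine prod_dvd_prod_of_dvd _ _ fun p _ => ?_
  rw [← pow_mul]
  refine pow_dvd_pow _ ?_
  calc (2 * u + v) * m / (p - 1) * Nat.totient b = Nat.totient b * ((2 * u + v) * m / (p - 1)) :=
        mul_comm _ _
    _ ≤ Nat.totient b * ((2 * u + v) * m) / (p - 1) := Nat.mul_div_le_mul_div_assoc _ _ _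
    _ = (2 * u + v) * m * Nat.totient b / (p - 1) := by rw [mul_comm (Nat.totient b)]

/-! ### The identity (3.2): `Φ_n = n!^{s+1} Φ₀`, `Φ₀(X − k)` a product of normalised progression polynomials -/

/-- One linear factor through the reduced fraction `θ = num/den`:
`X − k − um + j + θ = den⁻¹ · (den X + (num − den (k + um)) + den j)`. [folklore] -/
private theorem linear_factor_eq (θ : ℚ) (k u m j : ℕ) :
    (X - C (k : ℚ) - C ((u : ℚ) * m) + C (j : ℚ) + C θ : ℚ[X]) =
      C ((θ.den : ℚ)⁻¹) * (C (θ.den : ℚ) * X +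
        C (((θ.num - (θ.den : ℤ) * ((k : ℤ) + u * m) + (θ.den : ℤ) * (j : ℤ) : ℤ) : ℚ))) := by
  have hd : (θ.den : ℚ) ≠ 0 := by exact_mod_cast θ.pos.ne'
  have hnum : ((θ.num : ℤ) : ℚ) = θ * (θ.den : ℚ) := (Rat.mul_den_eq_num θ).symm
  apply Polynomial.funext
  intro x
  simp only [eval_add, eval_sub, eval_mul, eval_X, eval_C]
  push_cast
  rw [hnum]
  field_simp
  ring

/-- The polynomial of Prop. 3.2 for the zero `θ = a/b` at the pole `−k`, mapped to `ℚ[X]`. [folklore] -/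
private theorem map_G (θ : ℚ) (k u m M : ℕ) :
    (∏ j ∈ range M, (C (θ.den : ℤ) * X +
        C ((θ.num - (θ.den : ℤ) * ((k : ℤ) + u * m)) + (θ.den : ℤ) * (j : ℤ)))).map (Int.castRingHom ℚ) =
      ∏ j ∈ range M, (C (θ.den : ℚ) * X +
        C (((θ.num - (θ.den : ℤ) * ((k : ℤ) + u * m) + (θ.den : ℤ) * (j : ℤ) : ℤ) : ℚ))) := by
  rw [Polynomial.map_prod]
  refine prod_congr rfl fun j _ => ?_
  simp only [Polynomial.map_add, Polynomial.map_mul, Polynomial.map_C, Polynomial.map_X]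
  simp only [eq_intCast]
  push_cast
  ring_nf

/-- **The identity (3.2) at the pole `−k`**: with `Φ₀ = A₁ⁿA₂ⁿ/m!^{(2u+v)|𝓕_B|} · (X−um) ∏_θ ∏_j (X − um + j + θ)`
(so `Φ_n = n!^{s+1} Φ₀`), `Φ₀(X − k) = C(A₂ⁿ/∏_θ μ_θ) · (X − (k+um)) · ∏_θ [ μ_θ/m!^{2u+v} · G_{θ,k} ]`
where `G_{θ,k} = ∏_{j<(2u+v)m} (bX + (a − b(k+um)) + bj)` (`θ = a/b`) and `μ_θ = ∏_{p∣b} p^{⌊(2u+v)m/(p−1)⌋}`.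
[cite: LaiYu2020, §3 eq. (3.2) (R_n = n!^{s+1} ∏ F̃_{b,a} / ∏ (t+j)^{s+1})] -/
theorem Phi0_comp_eq (u v : ℕ) (B : ℝ) (m k : ℕ) :
    (C (((A₁pow u v B m : ℚ) * (A₂pow u v B m : ℚ)) /
          ((m.factorial : ℚ) ^ ((2 * u + v) * (zeroSet_finite B).toFinset.card))) *
        ((X - C ((u : ℚ) * m)) * ∏ θ ∈ (zeroSet_finite B).toFinset,
          ∏ j ∈ range ((2 * u + v) * m), (X - C ((u : ℚ) * m) + C (j : ℚ) + C θ))).comp (X - C (k : ℚ)) =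
      C ((A₂pow u v B m : ℚ) / ∏ θ ∈ (zeroSet_finite B).toFinset,
            ((∏ p ∈ θ.den.primeFactors, (p : ℤ) ^ ((2 * u + v) * m / (p - 1)) : ℤ) : ℚ)) *
        (X - C ((k : ℚ) + u * m)) *
        ∏ θ ∈ (zeroSet_finite B).toFinset,
          (C ((((∏ p ∈ θ.den.primeFactors, (p : ℤ) ^ ((2 * u + v) * m / (p - 1)) : ℤ) : ℚ)) /
              (m.factorial : ℚ) ^ (2 * u + v)) *
            (∏ j ∈ range ((2 * u + v) * m), (C (θ.den : ℤ) * X +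
              C ((θ.num - (θ.den : ℤ) * ((k : ℤ) + u * m)) + (θ.den : ℤ) * (j : ℤ)))).map
                (Int.castRingHom ℚ)) := by
  set F := (zeroSet_finite B).toFinset with hF
  set M := (2 * u + v) * m with hM
  -- nonvanishing constants
  have hA₁ : (A₁pow u v B m : ℚ) ≠ 0 := by
    rw [A₁pow]; push_cast
    exact prod_ne_zero_iff.2 fun b hb => pow_ne_zero _
      (by exact_mod_cast (((denominatorSet_finite B).mem_toFinset.1 hb).1).ne')
  have hμ : ∀ θ : ℚ, (((∏ p ∈ θ.den.primeFactors, (p : ℤ) ^ (M / (p - 1)) : ℤ) : ℚ)) ≠ 0 := by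
    intro θ
    push_cast
    exact prod_ne_zero_iff.2 fun p hp => pow_ne_zero _
      (by exact_mod_cast (Nat.prime_of_mem_primeFactors hp).ne_zero)
  have hμprod : ∏ θ ∈ F, (((∏ p ∈ θ.den.primeFactors, (p : ℤ) ^ (M / (p - 1)) : ℤ) : ℚ)) ≠ 0 :=
    prod_ne_zero_iff.2 fun θ _ => hμ θ
  have hmf : ((m.factorial : ℚ)) ≠ 0 := by positivity
  -- Step 1: push the composition inside
  have hcomp : ∀ θ ∈ F, ∀ j ∈ range M,
      (X - C ((u : ℚ) * m) + C (j : ℚ) + C θ : ℚ[X]).comp (X - C (k : ℚ)) =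
        C ((θ.den : ℚ)⁻¹) * (C (θ.den : ℚ) * X +
          C (((θ.num - (θ.den : ℤ) * ((k : ℤ) + u * m) + (θ.den : ℤ) * (j : ℤ) : ℤ) : ℚ))) := by
    intro θ _ j _
    rw [← linear_factor_eq θ k u m j]
    simp only [add_comp, sub_comp, X_comp, C_comp]
  rw [mul_comp, C_comp, mul_comp, sub_comp, X_comp, C_comp, Polynomial.prod_comp]
  have hinner : ∀ θ ∈ F, (∏ j ∈ range M, (X - C ((u : ℚ) * m) + C (j : ℚ) + C θ : ℚ[X])).comp
      (X - C (k : ℚ)) = C (((θ.den : ℚ) ^ M)⁻¹) *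
        (∏ j ∈ range M, (C (θ.den : ℤ) * X +
          C ((θ.num - (θ.den : ℤ) * ((k : ℤ) + u * m)) + (θ.den : ℤ) * (j : ℤ)))).map
            (Int.castRingHom ℚ) := by
    intro θ hθ
    rw [Polynomial.prod_comp, prod_congr rfl (hcomp θ hθ), prod_mul_distrib, prod_const, card_range,
      ← C_pow, inv_pow, map_G]
  rw [prod_congr rfl hinner, prod_mul_distrib]
  -- Step 2: `∏_θ C(den^{-M}) = C(A₁pow⁻¹)`
  have hdenprod : ∏ θ ∈ F, C (((θ.den : ℚ) ^ M)⁻¹) = C ((A₁pow u v B m : ℚ)⁻¹) := by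
    rw [← map_prod C, prod_inv_distrib, ← prod_den_pow_eq_A₁pow u v B m]
    push_cast
    rfl
  rw [hdenprod]
  -- Step 3: compare the constants
  set P : ℚ[X] := ∏ θ ∈ F, (∏ j ∈ range M, (C (θ.den : ℤ) * X +
    C ((θ.num - (θ.den : ℤ) * ((k : ℤ) + u * m)) + (θ.den : ℤ) * (j : ℤ)))).map (Int.castRingHom ℚ) with hP
  rw [prod_mul_distrib, ← map_prod C, ← hP]
  have e1 : (X - C (k : ℚ) - C ((u : ℚ) * m) : ℚ[X]) = X - C ((k : ℚ) + u * m) := by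
    rw [map_add]; ring
  rw [e1]
  have hb₂ : ∏ θ ∈ F, ((((∏ p ∈ θ.den.primeFactors, (p : ℤ) ^ (M / (p - 1)) : ℤ) : ℚ)) /
      (m.factorial : ℚ) ^ (2 * u + v)) =
      (∏ θ ∈ F, (((∏ p ∈ θ.den.primeFactors, (p : ℤ) ^ (M / (p - 1)) : ℤ) : ℚ))) /
        (m.factorial : ℚ) ^ ((2 * u + v) * F.card) := by
    rw [prod_div_distrib, prod_const, ← pow_mul]
  rw [hb₂]
  have key : (A₁pow u v B m : ℚ) * (A₂pow u v B m : ℚ) / (m.factorial : ℚ) ^ ((2 * u + v) * F.card) *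
      (A₁pow u v B m : ℚ)⁻¹ =
      (A₂pow u v B m : ℚ) / (∏ θ ∈ F, (((∏ p ∈ θ.den.primeFactors, (p : ℤ) ^ (M / (p - 1)) : ℤ) : ℚ))) *
        ((∏ θ ∈ F, (((∏ p ∈ θ.den.primeFactors, (p : ℤ) ^ (M / (p - 1)) : ℤ) : ℚ))) /
          (m.factorial : ℚ) ^ ((2 * u + v) * F.card)) := by
    field_simp
  calc C ((A₁pow u v B m : ℚ) * (A₂pow u v B m : ℚ) / (m.factorial : ℚ) ^ ((2 * u + v) * F.card)) *
        ((X - C ((k : ℚ) + u * m)) * (C ((A₁pow u v B m : ℚ)⁻¹) * P))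
      = C ((A₁pow u v B m : ℚ) * (A₂pow u v B m : ℚ) / (m.factorial : ℚ) ^ ((2 * u + v) * F.card) *
          (A₁pow u v B m : ℚ)⁻¹) * ((X - C ((k : ℚ) + u * m)) * P) := by
        rw [map_mul]; ring
    _ = C ((A₂pow u v B m : ℚ) / (∏ θ ∈ F, (((∏ p ∈ θ.den.primeFactors, (p : ℤ) ^ (M / (p - 1)) : ℤ) : ℚ))) *
        ((∏ θ ∈ F, (((∏ p ∈ θ.den.primeFactors, (p : ℤ) ^ (M / (p - 1)) : ℤ) : ℚ))) /
          (m.factorial : ℚ) ^ ((2 * u + v) * F.card))) * ((X - C ((k : ℚ) + u * m)) * P) := by rw [key]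
    _ = _ := by rw [map_mul]; ring

/-! ### `D`-integrality of the factors and the arithmetic lemma -/

/-- A polynomial with integer coefficients is `D`-integral. [folklore] -/
private theorem dInt_of_int_coeff {D : ℕ} {P : ℚ[X]} (h : ∀ ℓ : ℕ, ∃ z : ℤ, P.coeff ℓ = z) (ℓ : ℕ) :
    ∃ z : ℤ, (D : ℚ) ^ ℓ * P.coeff ℓ = z := by
  obtain ⟨z, hz⟩ := h ℓ
  exact ⟨D ^ ℓ * z, by rw [hz]; push_cast; ring⟩

/-- The factor `μ_θ/m!^{2u+v} · G_{θ,k}` is `D`-integral (Proposition 3.2). [cite: LaiYu2020, Prop. 3.2] -/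
private theorem dInt_factor {u v m D k : ℕ} (hm : 0 < m) (hD : ∀ i : ℕ, 1 ≤ i → i ≤ m → i ∣ D)
    (θ : ℚ) (ℓ : ℕ) :
    ∃ z : ℤ, (D : ℚ) ^ ℓ * ((C ((((∏ p ∈ θ.den.primeFactors, (p : ℤ) ^ ((2 * u + v) * m / (p - 1)) : ℤ) : ℚ)) /
        (m.factorial : ℚ) ^ (2 * u + v)) *
      (∏ j ∈ range ((2 * u + v) * m), (C (θ.den : ℤ) * X +
        C ((θ.num - (θ.den : ℤ) * ((k : ℤ) + u * m)) + (θ.den : ℤ) * (j : ℤ)))).map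
          (Int.castRingHom ℚ)).coeff ℓ) = z := by
  have h := prop32 θ.den θ.pos (θ.num - (θ.den : ℤ) * ((k : ℤ) + u * m)) ((2 * u + v) * m) hm hD ℓ
  rw [Nat.mul_div_cancel _ hm] at h
  obtain ⟨w, hw⟩ := h
  refine ⟨w, ?_⟩
  rw [coeff_C_mul, coeff_map, eq_intCast]
  have hmf : ((m.factorial : ℚ)) ^ (2 * u + v) ≠ 0 := by positivity
  have hw' : ((D : ℚ)) ^ ℓ * (((∏ p ∈ θ.den.primeFactors, (p : ℤ) ^ ((2 * u + v) * m / (p - 1)) : ℤ) : ℚ)) *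
      (((∏ j ∈ range ((2 * u + v) * m), (C (θ.den : ℤ) * X +
        C ((θ.num - (θ.den : ℤ) * ((k : ℤ) + u * m)) + (θ.den : ℤ) * (j : ℤ)))).coeff ℓ : ℤ) : ℚ) =
      ((m.factorial : ℚ)) ^ (2 * u + v) * w := by
    exact_mod_cast hw
  field_simp
  linear_combination hw'

/-- **Lai–Yu 2020, Lemma 3.3 (first half), for `R_n`** (PROVED): let `a_{i,k}` be partial-fraction
coefficients of `R_n` (`R_n(t) = ∑_{k=0}^{n} ∑_{i=1}^{s+1} a_{i,k}/(t+k)^i` off the poles; they exist by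
`exists_partialFraction`) and let `D` be any common multiple of `1, …, n` (`n = vm`; the printed case
is `D = d_n`). Then `D^{s+1−i} a_{i,k} ∈ ℤ` for all `1 ≤ i ≤ s+1`, `0 ≤ k ≤ n`.
[cite: LaiYu2020, Lemma 3.3 (proof: d_n^{s+1−i} a_{i,k} ∈ ℤ)] -/
theorem lemma33_coeff_isInt {u v s : ℕ} {B : ℝ} {m : ℕ} (hm : 0 < m) (hv : 0 < v) {D : ℕ}
    (hD : ∀ j : ℕ, 1 ≤ j → j ≤ v * m → j ∣ D) {a : ℕ → ℕ → ℚ}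
    (hPF : ∀ t : ℚ, (∀ j ∈ range (v * m + 1), t + j ≠ 0) →
      R u v s B m t = ∑ k ∈ range (v * m + 1), ∑ i ∈ Icc 1 (s + 1), a i k / (t + k) ^ i)
    {k : ℕ} (hk : k ∈ range (v * m + 1)) {i : ℕ} (hi : i ∈ Icc 1 (s + 1)) :
    ∃ z : ℤ, (D : ℚ) ^ (s + 1 - i) * a i k = z := by
  classical
  set F := (zeroSet_finite B).toFinset with hF
  set Φ₀ : ℚ[X] := C (((A₁pow u v B m : ℚ) * (A₂pow u v B m : ℚ)) /
      ((m.factorial : ℚ) ^ ((2 * u + v) * F.card))) *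
    ((X - C ((u : ℚ) * m)) * ∏ θ ∈ F,
      ∏ j ∈ range ((2 * u + v) * m), (X - C ((u : ℚ) * m) + C (j : ℚ) + C θ)) with hΦ₀
  -- the partial-fraction identity in the normalised form `Φ = n!^{s+1} Φ₀`
  have hPF' : ∀ t : ℚ, (∀ j ∈ range (v * m + 1), t + j ≠ 0) →
      (C (((v * m).factorial : ℚ) ^ (s + 1)) * Φ₀).eval t / (∏ j ∈ range (v * m + 1), (t + j)) ^ (s + 1) =
        ∑ k' ∈ range (v * m + 1), ∑ i ∈ Icc 1 (s + 1), a i k' / (t + k') ^ i := by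
    intro t ht
    rw [← hPF t ht, R_eq_eval_div]
    congr 1
    simp only [hΦ₀, eval_mul, eval_C]
    ring
  have hD' : ∀ j : ℕ, 1 ≤ j → j ≤ v * m → (j : ℤ) ∣ D := fun j h1 h2 => by exact_mod_cast hD j h1 h2
  have hDm : ∀ j : ℕ, 1 ≤ j → j ≤ m → j ∣ D := fun j h1 h2 =>
    hD j h1 (h2.trans (Nat.le_mul_of_pos_left m hv))
  refine partialFraction_coeff_isInt hPF' hD' hk (fun ℓ => ?_) hi
  -- `D`-integrality of `Φ₀(X - k)` via the identity (3.2)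
  rw [hΦ₀, hF, Phi0_comp_eq u v B m k]
  refine dInt_mul (dInt_mul (dInt_of_int_coeff fun ℓ' => ?_) (dInt_of_int_coeff fun ℓ' => ?_))
    (dInt_prod _ _ fun θ _ ℓ' => dInt_factor hm hDm θ ℓ') ℓ
  · -- the constant `A₂ⁿ/∏ μ_θ` is a natural number
    obtain ⟨q, hq⟩ := prod_mu_dvd_A₂pow u v B m
    refine ⟨if ℓ' = 0 then (q : ℤ) else 0, ?_⟩
    rw [coeff_C]
    have hμ0 : ∏ θ ∈ (zeroSet_finite B).toFinset,
        (((∏ p ∈ θ.den.primeFactors, (p : ℤ) ^ ((2 * u + v) * m / (p - 1)) : ℤ) : ℚ)) ≠ 0 :=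
      prod_ne_zero_iff.2 fun θ _ => by
        push_cast
        exact prod_ne_zero_iff.2 fun p hp => pow_ne_zero _
          (by exact_mod_cast (Nat.prime_of_mem_primeFactors hp).ne_zero)
    have hquot : (A₂pow u v B m : ℚ) / ∏ θ ∈ (zeroSet_finite B).toFinset,
        (((∏ p ∈ θ.den.primeFactors, (p : ℤ) ^ ((2 * u + v) * m / (p - 1)) : ℤ) : ℚ)) = q := by
      rw [div_eq_iff hμ0, hq]
      push_cast
      ring
    split_ifs with h
    · rw [hquot]; push_cast; rfl
    · push_cast; rfl
  · -- `X - C(k + um)` has integer coefficients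
    have e : (X - C ((k : ℚ) + u * m) : ℚ[X]) = (X - C ((k : ℤ) + u * m) : ℤ[X]).map (Int.castRingHom ℚ) := by
      rw [Polynomial.map_sub, Polynomial.map_X, Polynomial.map_C, eq_intCast]
      push_cast
      rfl
    rw [e, coeff_map, eq_intCast]
    exact ⟨_, rfl⟩

/-- **Corollary**: `D^{s+1−i} ρ_i ∈ ℤ` for `ρ_i = ∑_{k=0}^{n} a_{i,k}` (the printed first assertion of
Lemma 3.3, `d_n^{s+1−i} ρ_i ∈ ℤ`, for every `1 ≤ i ≤ s+1`). [cite: LaiYu2020, Lemma 3.3] -/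
theorem lemma33_rho_isInt {u v s : ℕ} {B : ℝ} {m : ℕ} (hm : 0 < m) (hv : 0 < v) {D : ℕ}
    (hD : ∀ j : ℕ, 1 ≤ j → j ≤ v * m → j ∣ D) {a : ℕ → ℕ → ℚ}
    (hPF : ∀ t : ℚ, (∀ j ∈ range (v * m + 1), t + j ≠ 0) →
      R u v s B m t = ∑ k ∈ range (v * m + 1), ∑ i ∈ Icc 1 (s + 1), a i k / (t + k) ^ i)
    {i : ℕ} (hi : i ∈ Icc 1 (s + 1)) :
    ∃ z : ℤ, (D : ℚ) ^ (s + 1 - i) * ∑ k ∈ range (v * m + 1), a i k = z := by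
  classical
  rw [mul_sum]
  have key : ∀ S : Finset ℕ, S ⊆ range (v * m + 1) →
      ∃ z : ℤ, ∑ k ∈ S, (D : ℚ) ^ (s + 1 - i) * a i k = z := by
    intro S
    induction S using Finset.induction_on with
    | empty => intro; exact ⟨0, by simp⟩
    | insert k' S' hk' ih =>
      intro hS
      obtain ⟨z₁, hz₁⟩ := lemma33_coeff_isInt hm hv hD hPF (hS (mem_insert_self k' S')) hi
      obtain ⟨z₂, hz₂⟩ := ih fun x hx => hS (mem_insert_of_mem hx)
      exact ⟨z₁ + z₂, by rw [sum_insert hk', hz₁, hz₂]; push_cast; ring⟩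
  exact key _ Subset.rfl

end Literature.NumberTheory.Irrationality.LaiYu2020

end
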